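import Literature.MathematicalPhysics.QuantumLattice.LayeredVariationalPressure
import HarnessLib

/-!
# The layered `t–t'` Hubbard crystal at `T > 0` in the grand-canonical ensemble: the 3D variational pressure lies in
# `[P_2D(β;t,t',U;μ,h), P_2D + β(4/π)Σ_b|tz_b|]`, and 2D GRAND-CANONICAL PRESSURES CERTIFY THE DENSITY AND THE MAGNETISATION
# OF 3D THERMAL EQUILIBRIUM STATES (slack `β(4/π)Σ|tz|`)

Topic `Literature/MathematicalPhysics/QuantumLattice` (family `hubbard`; crew hubbard-fast S2, D-0096 (iii) «interlayer coupling» at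
`T > 0`). `LayeredVariationalPressure` proved the abstract dimension raising for Araki–Moriya's variational pressure and the layered
one-band models WITHOUT chemical potential / field. This file dresses the layered `t–t'` Hubbard crystal with the on-site grand-canonical
terms and keys the 2D side to the tree's thermodynamic-limit GRAND-CANONICAL PRESSURE `gcPressureTT'Zeeman` (`TIVariationalPressure`
§4: `P_2(β, Φ(t,t',U) − μn − hm) = gcPressureTT'Zeeman β t t' U μ h`):

* §1 **On-site directions under pull-backs and stacks** (any dimension): the number and spin-imbalance conjugate densities of
  `ω ∘ Γ_f` are those of `ω` when `f 0 = 0` (`meanEnergy_numberInteraction_mapAct`, `meanEnergy_spinImbalanceInteraction_mapAct`),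
  and those of the stack `⊗ω₀` are those of `ω₀` (`…_stack`).
* §2 **The grand-canonical layered `t–t'` crystal** `gcLayeredHubbardTTPrime t t' U μ h w tz = Φ_layered − μ·n − h·(n↑−n↓)` on `ℤ³`
  (interlayer hoppings `tz_b` along `w_b`, `(w_b)₀ ≠ 0`): mean energy; stack energies = 2D grand-canonical energies
  (`meanEnergy_stack_gcLayeredHubbardTTPrime`); marginal energies up to `(4/π)Σ|tz|` (`…abs_meanEnergy_gcLayered…_sub_mapAct_le`).
* §3 **DIMENSION RAISING, GRAND-CANONICAL FORM**: for every `β`,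
  `P_3(β, gcLayered) ∈ [P_2(β, gcInteractionTT'), P_2 + |β|(4/π)Σ|tz|]` (`varPressure_gcLayeredHubbardTTPrime_mem_Icc`), and for
  `β ≥ 0`, `U ≥ 0` **`P_3(β, gcLayered) ∈ [gcPressureTT'Zeeman β t t' U μ h, gcPressureTT'Zeeman β t t' U μ h + β(4/π)Σ_b|tz_b|]`**
  (`varPressure_gcLayeredHubbardTTPrime_mem_Icc_gcPressureTT'Zeeman`), equality for decoupled layers (`…_zero`).
* §4 **3D THERMAL STATES READ BY 2D CERTIFICATES**: the layer marginal of an equilibrium state `ω` of the 3D crystal at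
  `(β; t,t',U; μ,h)` satisfies `gcPressureTT'Zeeman − β(4/π)Σ|tz| ≤ s̄(ω∘Γ_layer) − β u(ω∘Γ_layer)`
  (`IsVarEquilibrium.gcPressureTT'Zeeman_sub_le_layerMarginal`); hence the JOINT TANGENT PLANE WITH SLACK at every other parameter point
  (`…gcPressureTT'Zeeman_add_le_of_gcLayered`) and the **DENSITY AND MAGNETISATION WINDOWS**
  `ρ(ω) ∈ [(P(μ) − P(μ−δ) − ε)/(βδ), (P(μ+δ) − P(μ) + ε)/(βδ)]`, `m(ω) ∈ [(P(h) − P(h−δ) − ε)/(βδ), (P(h+δ) − P(h) + ε)/(βδ)]` with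
  `P = gcPressureTT'Zeeman` (2D!) and `ε = β(4/π)Σ_b|tz_b|` (`IsVarEquilibrium.density_mem_Icc_of_gcLayered`,
  `…spinImbalance_mem_Icc_of_gcLayered`): three certified 2D grand-canonical pressures bound the filling / magnetisation of every 3D
  thermal equilibrium state of the layered crystal, at the price `ε/(βδ)`.

Everything is PROVED; the one definition (`gcLayeredHubbardTTPrime`) has a body; no named fact, no number. HONEST SCOPE: the 3D objects
are VARIATIONAL (pressure `sup_{TI} [s̄ − βu]`, equilibrium = maximiser); no 3D thermodynamic-limit theorem for partition functions and no
existence/uniqueness of 3D equilibrium states is claimed; the slack is kinematic (`4/π` per unit interlayer amplitude).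

## Mathlib / tree search

REUSED: `varPressure_mem_Icc_of_stack_of_layerMarginal`, `IsVarEquilibrium.varPressure_sub_le_layerMarginal`, `varPressure_add_le_of_approx`,
`meanEnergy_mem_Icc_of_approx`, `meanEnergy_stack_layeredModel_of_isTranslationInvariant`,
`IsTranslationInvariant.abs_meanEnergy_layeredModel_sub_mapAct_le` (`LayeredVariationalPressure`); `gcInteractionTT'`, `meanEnergy_gcInteractionTT'`,
`varPressure_gcInteractionTT'_eq` (`TIVariationalPressure`); `numberInteraction`, `meanEnergy_numberInteraction`, `spinImbalanceInteraction`,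
`meanEnergy_spinImbalanceInteraction` (`TIGroundEnergyDensityResponse/ConservedDensities`); `layeredHubbardTTPrime`, `ttPrimeVec(_ne_zero/_mem_thicken_one)`,
`hubbardTTPrimeFermionInteraction_eq_vectorHoppingModel`, `stack`, `mapAct_layerHom_stack`, `density_stack`, `layerHom` (`LayeredLatticeEnergyTransport`);
`mapAct_expect`, `density_mapAct`, `fermionEmbed_numberOp` (`InfVolFermionStateLatticeMapPullback`, `InfVolFermionState`).
`lean search 'gcLayered|layered.*Zeeman|varPressure.*layeredHubbard'` (2026-08-28): only `LayeredVariationalPressure` (this session).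

## References

* O. Bratteli, A. Kishimoto, D. W. Robinson, Commun. Math. Phys. 64 (1978) 41, Thm. 2. [cite: BratteliKishimotoRobinson1978, Thm. 2 (condition 2)]
* R. B. Israel, *Convexity in the Theory of Lattice Gases* (1979), Thm. I.2.4, Thm. I.3.4. [cite: Israel1979, Thm. I.3.4]
* R. B. Griffiths, J. Math. Phys. 5 (1964) 1215, eq. (39) (convexity brackets of conjugate densities). [cite: Griffiths1964, Eq. (39) and Fig. 3]
* H. Araki, H. Moriya, Rev. Math. Phys. 15 (2003) 93, §11.1 Thm. 11.2, Thm. 12.11. [cite: ArakiMoriya2003, §11.1 Theorem 11.2]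
-/

noncomputable section

open scoped ComplexOrder BigOperators
open Finset Literature.InformationTheory.Entropy

namespace Literature.MathematicalPhysics.QuantumLattice

open Matrix HubbardWave0 Literature.Probability.LatticeModels ThermodynamicLimit

/-! ### §1 On-site directions under pull-backs and stacks -/

namespace InfVolFermionState

variable {d d' : ℕ}

/-- Local spin-resolved densities transfer along a pull-back: `(ν∘Γ_f)(n_{yτ}) = ν(n_{f(y)τ})`. [cite: ArakiMoriya2003, §4.1] -/
theorem expect_nAt_mapAct (ν : InfVolFermionState d') (f : Site d → Site d') (hf : Function.Injective f) (y : Site d)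
    (τ : Fin 2) :
    (ν.mapAct f hf).expect {y} (nAt y (mem_singleton_self y) τ) = ν.expect {f y} (nAt (f y) (mem_singleton_self (f y)) τ) := by
  have hmem : f y ∈ mapSet f ({y} : Finset (Site d)) := mem_mapSet_of_mem f (mem_singleton_self y)
  have hsub : ({f y} : Finset (Site d')) ⊆ mapSet f ({y} : Finset (Site d)) := singleton_subset_iff.2 hmem
  have hn : fermionEmbed (PolySite.mapEmb f hf ({y} : Finset (Site d))) (nAt y (mem_singleton_self y) τ) =
      fermionEmbed (PolySite.incl hsub) (nAt (f y) (mem_singleton_self (f y)) τ) := by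
    rw [nAt, nAt, fermionEmbed_numberOp, fermionEmbed_numberOp, PolySite.mapEmb_pt, PolySite.incl_pt]
  rw [mapAct_expect, hn, ν.compatible hsub]

/-- Local spin-resolved densities at the origin are unchanged by a pull-back fixing the origin. [cite: ArakiMoriya2003, §4.1] -/
theorem expect_nAt_zero_mapAct (ν : InfVolFermionState d') (f : Site d → Site d') (hf : Function.Injective f) (h0 : f 0 = 0)
    (τ : Fin 2) :
    (ν.mapAct f hf).expect {0} (nAt 0 (mem_singleton_self 0) τ) = ν.expect {0} (nAt 0 (mem_singleton_self 0) τ) := by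
  rw [expect_nAt_mapAct]
  have key : ∀ {x y : Site d'}, x = y →
      ν.expect {x} (nAt x (mem_singleton_self x) τ) = ν.expect {y} (nAt y (mem_singleton_self y) τ) := by
    intro x y h; subst h; rfl
  exact key h0

/-- **The spin imbalance of `ω ∘ Γ_f` is that of `ω`** (`f 0 = 0`; any range parameters). [cite: ArakiMoriya2003, §4.1] -/
theorem meanEnergy_spinImbalanceInteraction_mapAct (ν : InfVolFermionState d') (f : Site d → Site d') (hf : Function.Injective f)
    (h0 : f 0 = 0) (R R' : ℝ) :
    (ν.mapAct f hf).meanEnergy (spinImbalanceInteraction d) R = ν.meanEnergy (spinImbalanceInteraction d') R' := by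
  rw [meanEnergy_spinImbalanceInteraction, meanEnergy_spinImbalanceInteraction, expect_nAt_zero_mapAct ν f hf h0,
    expect_nAt_zero_mapAct ν f hf h0]

/-- **The density direction of `ω ∘ Γ_f` is that of `ω`** (`f 0 = 0`). [cite: ArakiMoriya2003, §4.1] -/
theorem meanEnergy_numberInteraction_mapAct (ν : InfVolFermionState d') (f : Site d → Site d') (hf : Function.Injective f)
    (h0 : f 0 = 0) (R R' : ℝ) :
    (ν.mapAct f hf).meanEnergy (numberInteraction d) R = ν.meanEnergy (numberInteraction d') R' := by
  rw [meanEnergy_numberInteraction, meanEnergy_numberInteraction, density_mapAct ν f hf h0]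

/-- **The spin imbalance of the stack is that of the layer state.** [cite: ArakiMoriya2003, §11.1 Theorem 11.2] -/
theorem meanEnergy_spinImbalanceInteraction_stack (ω₀ : InfVolFermionState d) (h : ω₀.IsEven) (R R' : ℝ) :
    (ω₀.stack h).meanEnergy (spinImbalanceInteraction (d + 1)) R' = ω₀.meanEnergy (spinImbalanceInteraction d) R := by
  conv_rhs => rw [← mapAct_layerHom_stack ω₀ h]
  rw [meanEnergy_spinImbalanceInteraction_mapAct _ (layerHom d) (layerHom_injective d) (map_zero _) R R']

/-- **The density direction of the stack is that of the layer state.** [cite: ArakiMoriya2003, §11.1 Theorem 11.2] -/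
theorem meanEnergy_numberInteraction_stack (ω₀ : InfVolFermionState d) (h : ω₀.IsEven) (R R' : ℝ) :
    (ω₀.stack h).meanEnergy (numberInteraction (d + 1)) R' = ω₀.meanEnergy (numberInteraction d) R := by
  rw [meanEnergy_numberInteraction, meanEnergy_numberInteraction, density_stack]

end InfVolFermionState

/-! ### §2 The grand-canonical layered `t–t'` Hubbard crystal -/

section GCLayered

variable {κ : Type*} [Fintype κ]

/-- **The grand-canonical layered `t–t'` Hubbard crystal on `ℤ³`**: `Φ_layered(t,t',U; w,tz) − μ·n − h·(n↑ − n↓)` — the in-plane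
`t–t'–U` model in every layer, interlayer hoppings `tz_b` along `w_b`, and the on-site grand-canonical terms.
[cite: PavariniEtAl2001, eq. (1)] [cite: ArakiMoriya2003, §5.1] -/
def gcLayeredHubbardTTPrime (t t' U μ hz : ℝ) (w : κ → Site 3) (tz : κ → ℝ) : FermionInteraction 3 :=
  FermionInteraction.linearFamily (layeredHubbardTTPrime t t' U w tz)
    ![numberInteraction 3, spinImbalanceInteraction 3] ![-μ, -hz]

/-- Its mean energy: `e_{gcLayered}(ω) = e_{layered}(ω) − μ·e_n(ω) − h·e_s(ω)`. [cite: ArakiMoriya2003, §5.1] -/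
theorem InfVolFermionState.meanEnergy_gcLayeredHubbardTTPrime (ω : InfVolFermionState 3) (t t' U μ hz : ℝ) (w : κ → Site 3)
    (tz : κ → ℝ) (R : ℝ) :
    ω.meanEnergy (gcLayeredHubbardTTPrime t t' U μ hz w tz) R =
      ω.meanEnergy (layeredHubbardTTPrime t t' U w tz) R - μ * ω.meanEnergy (numberInteraction 3) R -
        hz * ω.meanEnergy (spinImbalanceInteraction 3) R := by
  rw [gcLayeredHubbardTTPrime, ω.meanEnergy_linearFamily, Fin.sum_univ_two]
  simp only [Matrix.cons_val_zero, Matrix.cons_val_one]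
  ring

/-- The 2D grand-canonical `t–t'` interaction in the same form. [cite: ArakiMoriya2003, §5.1] -/
theorem InfVolFermionState.meanEnergy_gcInteractionTT'_eq (ω : InfVolFermionState 2) (t t' U μ hz R : ℝ) :
    ω.meanEnergy (gcInteractionTT' t t' U μ hz) R =
      ω.meanEnergy (hubbardTTPrimeFermionInteraction t t' U) R - μ * ω.meanEnergy (numberInteraction 2) R -
        hz * ω.meanEnergy (spinImbalanceInteraction 2) R := by
  rw [gcInteractionTT', ω.meanEnergy_linearFamily, Fin.sum_univ_two]
  simp only [Matrix.cons_val_zero, Matrix.cons_val_one]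
  ring

/-- **Stack energies**: the stack of a translation-invariant 2D state evaluates the grand-canonical layered crystal (range `R' ≥ 1`
containing the `w_b`, `(w_b)₀ ≠ 0`) exactly as the state evaluates the 2D grand-canonical interaction.
[cite: ArakiMoriya2003, §11.1 Theorem 11.2] -/
theorem meanEnergy_stack_gcLayeredHubbardTTPrime (t t' U μ hz : ℝ) {w : κ → Site 3} (hw : ∀ b, w b 0 ≠ 0) (tz : κ → ℝ)
    {R' : ℝ} (hR' : 1 ≤ R') (hwR' : ∀ b, w b ∈ thicken ({0} : Finset (Site 3)) R')
    (ω₀ : InfVolFermionState 2) (hω₀ : ω₀.IsTranslationInvariant) :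
    (ω₀.stack (hω₀.isEven two_pos)).meanEnergy (gcLayeredHubbardTTPrime t t' U μ hz w tz) R' =
      ω₀.meanEnergy (gcInteractionTT' t t' U μ hz) 1 := by
  rw [InfVolFermionState.meanEnergy_gcLayeredHubbardTTPrime, ω₀.meanEnergy_gcInteractionTT'_eq,
    InfVolFermionState.meanEnergy_numberInteraction_stack ω₀ _ 1 R',
    InfVolFermionState.meanEnergy_spinImbalanceInteraction_stack ω₀ _ 1 R', layeredHubbardTTPrime,
    hubbardTTPrimeFermionInteraction_eq_vectorHoppingModel,
    meanEnergy_stack_layeredModel_of_isTranslationInvariant two_pos U ttPrimeVec_ne_zero (ttPrimeAmp t t') hw tz le_rfl hR'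
      ttPrimeVec_mem_thicken_one hwR' ω₀ hω₀]

/-- **Marginal energies**: for every translation-invariant state `ω` of `ℤ³`,
`|e_{gcLayered}(ω) − u_{2D}(ω ∘ Γ_layer)| ≤ (4/π)Σ_b|tz_b|` (`u_{2D}` the 2D grand-canonical energy of the layer marginal).
[cite: LiebWuPhysicaA2003, §4 and §6 Remark (A)] [cite: BratteliKishimotoRobinson1978, Thm. 2 (condition 2)] -/
theorem InfVolFermionState.IsTranslationInvariant.abs_meanEnergy_gcLayeredHubbardTTPrime_sub_mapAct_le
    {ω : InfVolFermionState 3} (hω : ω.IsTranslationInvariant) (t t' U μ hz : ℝ) {w : κ → Site 3} (hw : ∀ b, w b ≠ 0)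
    (tz : κ → ℝ) {R' : ℝ} (hR' : 1 ≤ R') (hwR' : ∀ b, w b ∈ thicken ({0} : Finset (Site 3)) R') :
    |ω.meanEnergy (gcLayeredHubbardTTPrime t t' U μ hz w tz) R' -
        (ω.mapAct (layerHom 2) (layerHom_injective 2)).meanEnergy (gcInteractionTT' t t' U μ hz) 1| ≤
      4 / Real.pi * ∑ b, |tz b| := by
  rw [ω.meanEnergy_gcLayeredHubbardTTPrime, InfVolFermionState.meanEnergy_gcInteractionTT'_eq,
    InfVolFermionState.meanEnergy_numberInteraction_mapAct ω (layerHom 2) (layerHom_injective 2) (map_zero _) 1 R',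
    InfVolFermionState.meanEnergy_spinImbalanceInteraction_mapAct ω (layerHom 2) (layerHom_injective 2) (map_zero _) 1 R',
    layeredHubbardTTPrime, hubbardTTPrimeFermionInteraction_eq_vectorHoppingModel]
  have h := hω.abs_meanEnergy_layeredModel_sub_mapAct_le U ttPrimeVec_ne_zero (ttPrimeAmp t t') hw tz le_rfl hR'
    ttPrimeVec_mem_thicken_one hwR'
  have e : ω.meanEnergy (layeredModel U ttPrimeVec (ttPrimeAmp t t') w tz) R' - μ * ω.meanEnergy (numberInteraction 3) R' -
        hz * ω.meanEnergy (spinImbalanceInteraction 3) R' -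
      ((ω.mapAct (layerHom 2) (layerHom_injective 2)).meanEnergy (vectorHoppingModel U ttPrimeVec (ttPrimeAmp t t')) 1 -
        μ * ω.meanEnergy (numberInteraction 3) R' - hz * ω.meanEnergy (spinImbalanceInteraction 3) R') =
      ω.meanEnergy (layeredModel U ttPrimeVec (ttPrimeAmp t t') w tz) R' -
        (ω.mapAct (layerHom 2) (layerHom_injective 2)).meanEnergy (vectorHoppingModel U ttPrimeVec (ttPrimeAmp t t')) 1 := by
    ring
  rw [e]
  exact h

/-! ### §3 Dimension raising, grand-canonical form -/

/-- **T > 0 DIMENSION RAISING, GRAND-CANONICAL INTERACTION FORM** (every `β`; `(w_b)₀ ≠ 0`, `R' ≥ 1` containing the `w_b`):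
`P_3(β, gcLayered) ∈ [P_2(β, Φ(t,t',U) − μn − hm), P_2 + |β|(4/π)Σ_b|tz_b|]`.
[cite: BratteliKishimotoRobinson1978, Thm. 2 (condition 2)] [cite: Israel1979, Thm. I.3.4] -/
theorem varPressure_gcLayeredHubbardTTPrime_mem_Icc (β t t' U μ hz : ℝ) {w : κ → Site 3} (hw : ∀ b, w b 0 ≠ 0) (tz : κ → ℝ)
    {R' : ℝ} (hR' : 1 ≤ R') (hwR' : ∀ b, w b ∈ thicken ({0} : Finset (Site 3)) R') :
    (gcLayeredHubbardTTPrime t t' U μ hz w tz).varPressure β R' ∈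
      Set.Icc ((gcInteractionTT' t t' U μ hz).varPressure β 1)
        ((gcInteractionTT' t t' U μ hz).varPressure β 1 + |β| * (4 / Real.pi * ∑ b, |tz b|)) :=
  varPressure_mem_Icc_of_stack_of_layerMarginal β two_pos
    (meanEnergy_stack_gcLayeredHubbardTTPrime t t' U μ hz hw tz hR' hwR')
    (fun ω hω => hω.abs_meanEnergy_gcLayeredHubbardTTPrime_sub_mapAct_le t t' U μ hz
      (fun b h0 => hw b (by rw [h0]; rfl)) tz hR' hwR')

/-- **T > 0 DIMENSION RAISING KEYED TO THE 2D GRAND-CANONICAL PRESSURE** (`β ≥ 0`, `U ≥ 0`):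
`P_3(β, gcLayered(t,t',U,μ,h; w,tz)) ∈ [gcPressureTT'Zeeman β t t' U μ h, gcPressureTT'Zeeman β t t' U μ h + β(4/π)Σ_b|tz_b|]` — the
2D thermodynamic-limit pressure (a NUMBER the tree's certificates bound) controls the 3D layered crystal's variational pressure.
[cite: BratteliKishimotoRobinson1978, Thm. 2 (condition 2)] [cite: Israel1979, Thm. I.3.4] -/
theorem varPressure_gcLayeredHubbardTTPrime_mem_Icc_gcPressureTT'Zeeman {β : ℝ} (hβ : 0 ≤ β) (t t' : ℝ) {U : ℝ} (hU : 0 ≤ U)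
    (μ hz : ℝ) {w : κ → Site 3} (hw : ∀ b, w b 0 ≠ 0) (tz : κ → ℝ) {R' : ℝ} (hR' : 1 ≤ R')
    (hwR' : ∀ b, w b ∈ thicken ({0} : Finset (Site 3)) R') :
    (gcLayeredHubbardTTPrime t t' U μ hz w tz).varPressure β R' ∈
      Set.Icc (gcPressureTT'Zeeman β t t' U μ hz) (gcPressureTT'Zeeman β t t' U μ hz + β * (4 / Real.pi * ∑ b, |tz b|)) := by
  have h := varPressure_gcLayeredHubbardTTPrime_mem_Icc β t t' U μ hz hw tz hR' hwR'
  rw [varPressure_gcInteractionTT'_eq hβ t t' hU μ hz, abs_of_nonneg hβ] at h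
  exact h

/-- **Decoupled layers**: at `tz = 0` the 3D grand-canonical variational pressure IS the 2D grand-canonical pressure (`β ≥ 0`, `U ≥ 0`).
[cite: ArakiMoriya2003, §11.1 Theorem 11.2] -/
theorem varPressure_gcLayeredHubbardTTPrime_zero {β : ℝ} (hβ : 0 ≤ β) (t t' : ℝ) {U : ℝ} (hU : 0 ≤ U) (μ hz : ℝ)
    {w : κ → Site 3} (hw : ∀ b, w b 0 ≠ 0) {R' : ℝ} (hR' : 1 ≤ R') (hwR' : ∀ b, w b ∈ thicken ({0} : Finset (Site 3)) R') :
    (gcLayeredHubbardTTPrime t t' U μ hz w fun _ => 0).varPressure β R' = gcPressureTT'Zeeman β t t' U μ hz := by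
  have h := varPressure_gcLayeredHubbardTTPrime_mem_Icc_gcPressureTT'Zeeman hβ t t' hU μ hz hw (fun _ => 0) hR' hwR'
  simp only [abs_zero, Finset.sum_const_zero, mul_zero, add_zero] at h
  exact le_antisymm h.2 h.1

/-! ### §4 3D thermal equilibrium states read by 2D certificates -/

/-- **The layer marginal of a 3D thermal equilibrium state is a `β(4/π)Σ|tz|`-approximate 2D equilibrium**:
`gcPressureTT'Zeeman β t t' U μ h − β(4/π)Σ_b|tz_b| ≤ s̄(ω∘Γ_layer) − β u(ω∘Γ_layer)` (`β ≥ 0`, `U ≥ 0`).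
[cite: BratteliKishimotoRobinson1978, Thm. 2 (condition 2)] [cite: ArakiMoriya2003, Theorem 12.11] -/
theorem InfVolFermionState.IsVarEquilibrium.gcPressureTT'Zeeman_sub_le_layerMarginal {β : ℝ} (hβ : 0 ≤ β) (t t' : ℝ) {U : ℝ}
    (hU : 0 ≤ U) (μ hz : ℝ) {w : κ → Site 3} (hw : ∀ b, w b 0 ≠ 0) (tz : κ → ℝ) {R' : ℝ} (hR' : 1 ≤ R')
    (hwR' : ∀ b, w b ∈ thicken ({0} : Finset (Site 3)) R') {ω : InfVolFermionState 3}
    (hω : ω.IsVarEquilibrium β (gcLayeredHubbardTTPrime t t' U μ hz w tz) R') :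
    gcPressureTT'Zeeman β t t' U μ hz - β * (4 / Real.pi * ∑ b, |tz b|) ≤
      (ω.mapAct (layerHom 2) (layerHom_injective 2)).entropyDensitySup -
        β * (ω.mapAct (layerHom 2) (layerHom_injective 2)).meanEnergy (gcInteractionTT' t t' U μ hz) 1 := by
  have h := hω.varPressure_sub_le_layerMarginal β two_pos
    (meanEnergy_stack_gcLayeredHubbardTTPrime t t' U μ hz hw tz hR' hwR')
    (fun ω hω => hω.abs_meanEnergy_gcLayeredHubbardTTPrime_sub_mapAct_le t t' U μ hz
      (fun b h0 => hw b (by rw [h0]; rfl)) tz hR' hwR')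
  rw [varPressure_gcInteractionTT'_eq hβ t t' hU μ hz, abs_of_nonneg hβ] at h
  exact h

/-- **JOINT TANGENT PLANE WITH SLACK for 3D thermal states**: for the layer marginal `m = ω∘Γ_layer` of a 3D equilibrium state at
`(β; t,t',U; μ,h)` and every other parameter point `(β₁; t₁,t'₁,U₁; μ₁,h₁)` (`β, β₁ ≥ 0`, `U, U₁ ≥ 0`):
`P(β₁; x₁) ≥ P(β; x) + β u_x(m) − β₁ u_{x₁}(m) − β(4/π)Σ|tz|` with `P = gcPressureTT'Zeeman` (2D pressures).
[cite: Israel1979, Thm. I.2.4] [cite: Griffiths1964, Eq. (39) and Fig. 3] -/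
theorem InfVolFermionState.IsVarEquilibrium.gcPressureTT'Zeeman_add_le_of_gcLayered {β : ℝ} (hβ : 0 ≤ β) (t t' : ℝ) {U : ℝ}
    (hU : 0 ≤ U) (μ hz : ℝ) {w : κ → Site 3} (hw : ∀ b, w b 0 ≠ 0) (tz : κ → ℝ) {R' : ℝ} (hR' : 1 ≤ R')
    (hwR' : ∀ b, w b ∈ thicken ({0} : Finset (Site 3)) R') {ω : InfVolFermionState 3}
    (hω : ω.IsVarEquilibrium β (gcLayeredHubbardTTPrime t t' U μ hz w tz) R')
    {β₁ : ℝ} (hβ₁ : 0 ≤ β₁) (t₁ t'₁ : ℝ) {U₁ : ℝ} (hU₁ : 0 ≤ U₁) (μ₁ hz₁ : ℝ) :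
    gcPressureTT'Zeeman β t t' U μ hz +
          β * (ω.mapAct (layerHom 2) (layerHom_injective 2)).meanEnergy (gcInteractionTT' t t' U μ hz) 1 -
        β₁ * (ω.mapAct (layerHom 2) (layerHom_injective 2)).meanEnergy (gcInteractionTT' t₁ t'₁ U₁ μ₁ hz₁) 1 -
        β * (4 / Real.pi * ∑ b, |tz b|) ≤ gcPressureTT'Zeeman β₁ t₁ t'₁ U₁ μ₁ hz₁ := by
  have happ := hω.gcPressureTT'Zeeman_sub_le_layerMarginal hβ t t' hU μ hz hw tz hR' hwR'
  rw [← varPressure_gcInteractionTT'_eq hβ t t' hU μ hz] at happ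
  have h := InfVolFermionState.varPressure_add_le_of_approx (hω.1.mapAct (layerHom 2) (layerHom_injective 2)) happ β₁
    (gcInteractionTT' t₁ t'₁ U₁ μ₁ hz₁) 1
  rw [varPressure_gcInteractionTT'_eq hβ t t' hU μ hz, varPressure_gcInteractionTT'_eq hβ₁ t₁ t'₁ hU₁ μ₁ hz₁] at h
  exact h

/-- Moving the chemical potential is a coordinate update of the grand-canonical linear family. [cite: ArakiMoriya2003, §5.1] -/
theorem gcInteractionTT'_update_mu (t t' U μ hz δ : ℝ) :
    FermionInteraction.linearFamily (hubbardTTPrimeFermionInteraction t t' U) ![numberInteraction 2, spinImbalanceInteraction 2]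
        (![-μ, -hz] + Pi.single 0 δ) = gcInteractionTT' t t' U (μ - δ) hz := by
  rw [gcInteractionTT']
  congr 1
  ext i
  (fin_cases i <;> simp); ring

/-- Moving the field is a coordinate update of the grand-canonical linear family. [cite: ArakiMoriya2003, §5.1] -/
theorem gcInteractionTT'_update_h (t t' U μ hz δ : ℝ) :
    FermionInteraction.linearFamily (hubbardTTPrimeFermionInteraction t t' U) ![numberInteraction 2, spinImbalanceInteraction 2]
        (![-μ, -hz] + Pi.single 1 δ) = gcInteractionTT' t t' U μ (hz - δ) := by
  rw [gcInteractionTT']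
  congr 1
  ext i
  (fin_cases i <;> simp); ring

/-- **DENSITY WINDOW FOR 3D THERMAL STATES FROM THREE 2D PRESSURES**: for an equilibrium state `ω` of the layered grand-canonical
crystal at `(β; t,t',U; μ,h)` (`β > 0`, `U ≥ 0`) and every `δ > 0`, with `P(·) = gcPressureTT'Zeeman β t t' U · h` and
`ε = β(4/π)Σ_b|tz_b|`:  `(P(μ) − P(μ−δ) − ε)/(βδ) ≤ ρ(ω) ≤ (P(μ+δ) − P(μ) + ε)/(βδ)`.
[cite: Griffiths1964, Eq. (39) and Fig. 3] [cite: Israel1979, Thm. I.2.4] -/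
theorem InfVolFermionState.IsVarEquilibrium.density_mem_Icc_of_gcLayered {β : ℝ} (hβ : 0 < β) (t t' : ℝ) {U : ℝ}
    (hU : 0 ≤ U) (μ hz : ℝ) {w : κ → Site 3} (hw : ∀ b, w b 0 ≠ 0) (tz : κ → ℝ) {R' : ℝ} (hR' : 1 ≤ R')
    (hwR' : ∀ b, w b ∈ thicken ({0} : Finset (Site 3)) R') {ω : InfVolFermionState 3}
    (hω : ω.IsVarEquilibrium β (gcLayeredHubbardTTPrime t t' U μ hz w tz) R') {δ : ℝ} (hδ : 0 < δ) :
    ω.density ∈ Set.Icc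
      ((gcPressureTT'Zeeman β t t' U μ hz - gcPressureTT'Zeeman β t t' U (μ - δ) hz - β * (4 / Real.pi * ∑ b, |tz b|)) /
        (β * δ))
      ((gcPressureTT'Zeeman β t t' U (μ + δ) hz - gcPressureTT'Zeeman β t t' U μ hz + β * (4 / Real.pi * ∑ b, |tz b|)) /
        (β * δ)) := by
  have happ := hω.gcPressureTT'Zeeman_sub_le_layerMarginal hβ.le t t' hU μ hz hw tz hR' hwR'
  rw [← varPressure_gcInteractionTT'_eq hβ.le t t' hU μ hz] at happ
  have h := InfVolFermionState.meanEnergy_mem_Icc_of_approx (Ψ₀ := hubbardTTPrimeFermionInteraction t t' U)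
    (Ψv := ![numberInteraction 2, spinImbalanceInteraction 2]) (θ := ![-μ, -hz])
    (hω.1.mapAct (layerHom 2) (layerHom_injective 2)) hβ happ 0 hδ
  rw [gcInteractionTT'_update_mu, gcInteractionTT'_update_mu, sub_neg_eq_add] at h
  simp only [Matrix.cons_val_zero] at h
  rw [← gcInteractionTT', varPressure_gcInteractionTT'_eq hβ.le t t' hU μ hz,
    varPressure_gcInteractionTT'_eq hβ.le t t' hU (μ - δ) hz, varPressure_gcInteractionTT'_eq hβ.le t t' hU (μ + δ) hz,
    InfVolFermionState.meanEnergy_numberInteraction, InfVolFermionState.density_mapAct _ _ _ (map_zero _)] at h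
  exact h

/-- **MAGNETISATION WINDOW FOR 3D THERMAL STATES FROM THREE 2D PRESSURES**: same with the field, `P(·) = gcPressureTT'Zeeman β t t' U μ ·`:
`(P(h) − P(h−δ) − ε)/(βδ) ≤ m(ω) ≤ (P(h+δ) − P(h) + ε)/(βδ)` (`m(ω) = ρ↑ − ρ↓` at the origin, read through the layer marginal).
[cite: Griffiths1964, Eq. (39) and Fig. 3] [cite: Israel1979, Thm. I.2.4] -/
theorem InfVolFermionState.IsVarEquilibrium.spinImbalance_mem_Icc_of_gcLayered {β : ℝ} (hβ : 0 < β) (t t' : ℝ) {U : ℝ}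
    (hU : 0 ≤ U) (μ hz : ℝ) {w : κ → Site 3} (hw : ∀ b, w b 0 ≠ 0) (tz : κ → ℝ) {R' : ℝ} (hR' : 1 ≤ R')
    (hwR' : ∀ b, w b ∈ thicken ({0} : Finset (Site 3)) R') {ω : InfVolFermionState 3}
    (hω : ω.IsVarEquilibrium β (gcLayeredHubbardTTPrime t t' U μ hz w tz) R') {δ : ℝ} (hδ : 0 < δ) :
    ω.meanEnergy (spinImbalanceInteraction 3) R' ∈ Set.Icc
      ((gcPressureTT'Zeeman β t t' U μ hz - gcPressureTT'Zeeman β t t' U μ (hz - δ) - β * (4 / Real.pi * ∑ b, |tz b|)) /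
        (β * δ))
      ((gcPressureTT'Zeeman β t t' U μ (hz + δ) - gcPressureTT'Zeeman β t t' U μ hz + β * (4 / Real.pi * ∑ b, |tz b|)) /
        (β * δ)) := by
  have happ := hω.gcPressureTT'Zeeman_sub_le_layerMarginal hβ.le t t' hU μ hz hw tz hR' hwR'
  rw [← varPressure_gcInteractionTT'_eq hβ.le t t' hU μ hz] at happ
  have h := InfVolFermionState.meanEnergy_mem_Icc_of_approx (Ψ₀ := hubbardTTPrimeFermionInteraction t t' U)
    (Ψv := ![numberInteraction 2, spinImbalanceInteraction 2]) (θ := ![-μ, -hz])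
    (hω.1.mapAct (layerHom 2) (layerHom_injective 2)) hβ happ 1 hδ
  rw [gcInteractionTT'_update_h, gcInteractionTT'_update_h, sub_neg_eq_add] at h
  simp only [Matrix.cons_val_one, Matrix.cons_val_zero] at h
  rw [← gcInteractionTT', varPressure_gcInteractionTT'_eq hβ.le t t' hU μ hz,
    varPressure_gcInteractionTT'_eq hβ.le t t' hU μ (hz - δ), varPressure_gcInteractionTT'_eq hβ.le t t' hU μ (hz + δ),
    InfVolFermionState.meanEnergy_spinImbalanceInteraction_mapAct ω (layerHom 2) (layerHom_injective 2) (map_zero _) 1 R'] at h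
  exact h

end GCLayered

end Literature.MathematicalPhysics.QuantumLattice

end
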